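import Literature.Analysis.Calculus.QuadraticMapEigenDirections
import Mathlib.Analysis.Calculus.FDeriv.Bilinear
import Mathlib.Analysis.Calculus.FDeriv.Add
import HarnessLib

/-!
# Symmetries of the renormalisation map of a quadratic map: equivariance, orbits of zeros, «relative» eigen-directions carry no zero

Summits/NavierStokesRegularity support file for item stmt-NavierStokesRegularity-0155 (`DssFarFieldSlaving.BlowupTypeIDssProfile`, the
certificate endpoint of the profile-search zones Z2/Z7 of cell ns-blowup); everything proved; no definitions, no named facts; pure linear algebra
on top of `Literature/Analysis/Calculus/QuadraticMapEigenDirections.lean` (p500757: the nonzero zeros of `x ↦ A x + Q x x` are exactly the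
rescalings of the real eigen-directions `Φ⁻¹ (Q v v) = μ • v`, `μ ≠ 0`, of the renormalisation map `N v := Φ⁻¹ (Q v v)`).

Setting: a pair of bounded linear maps `(T, S)` on `(X, Y)` intertwining the linear part (`Φ (T x) = S (Φ x)`, `Φ` realising `A`) and the
bilinear part (`Q (T x) (T y) = S (Q x y)`) — an element of a symmetry group of the quadratic map (for the Z7 space–time map: the `s`-translations
and the rotations about `e₃`, acting diagonally on the `(k, m)` modes).  Then:

* `renorm_equivariant` — `N (T v) = T (N v)`;
* `quadratic_zero_map_of_equivariant` — zeros come in `T`-orbits;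
* `not_quadratic_zero_smul_of_renorm_eq_smul_of_notMem_span` — a «RELATIVE eigen-direction» `N v = μ • w` with `w ∉ ℝ v` (typically
  `w = T v` for a symmetry that MOVES the direction `v`) carries NO zero on the line `ℝ v`: `A (c • v) + Q (c • v) (c • v) ≠ 0` for all `c ≠ 0`;
* `renorm_eq_smul_map_of_equivariant` — relative eigen-directions propagate along the orbit with the same `(μ, T)`, so applying the symmetry
  never promotes a relative eigen-direction to a genuine one;
* `renorm_eq_smul_of_relative_of_map_eq_smul` — conversely, if the aligning symmetry FIXES the direction (`T v = v`), a relative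
  eigen-direction is a genuine one (and hence carries the zero `(-μ⁻¹) • v`, `quadratic_zero_of_relative_of_map_eq`).

Appended (same day): the LINEARISATION at a zero — `hasFDerivAt_quadratic` (the Fréchet derivative of `x ↦ A x + Q x x` is
`A + Q x + Q.flip x`), the EULER IDENTITY `linearisation_apply_self_of_quadratic_zero` (at a zero, `DG(x) x = −A x`; preconditioned
form `precond_linearisation_apply_self_of_quadratic_zero`: `Φ⁻¹ DG(x) x = −x`, i.e. the preconditioned Jacobian has the eigenvalue `−1` on the
radial direction at EVERY nonzero zero — Petviashvili's `p = 2` radial instability, and a float-checkable sanity identity for any future CANDIDATE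
of the certificate ladder), and `linearisation_apply_generator_of_equivariant` / `…_eq_zero_of_quadratic_zero` (generators of a differentiable
symmetry group are mapped by `DG(x)` to `S′(0) G(x)`, hence lie in the kernel at a zero — the neutral directions of the shape map);
and `quadratic_apply_wouldBeZero` / `norm_quadratic_apply_wouldBeZero` (the residual of the candidate zero `(−μ⁻¹) • v` equals
`μ⁻¹ • Φ (μ⁻¹ • Φ⁻¹ (Q v v) − v)` — the shape-map defect transported by `Φ`).

USE (cell ns-blowup, zone Z7, search device (g) «shape-sphere / Petviashvili-type iteration» `v ↦ ±N v/‖N v‖` with PHASE ALIGNMENT, i.e. the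
iteration on the quotient of the unit sphere by the symmetry group; HOME/profile/z7/DEVICE-G-PROPOSAL.md): a fixed point of the ALIGNED iteration is
a relative eigen-direction `N v = μ • T v`; by the third lemma it is a zero direction of the truncated map only if the aligning `T` fixes `v` — so
the ending FIXED must be lettered on the UN-aligned defect `‖±N v/‖N v‖ − v‖`, the aligned defect being a drift/cycle diagnostic.  Honest framing:
statements about an abstract quadratic map between real normed spaces; nothing here is a statement about Navier–Stokes, about any truncation, or
about convergence of any iteration. [folklore]
-/

noncomputable section

set_option linter.dupNamespace false

namespace Summit.NavierStokesRegularity.NavierStokesRegularity.Theorems.QuadraticRenormSymmetry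

open Literature.Analysis.Calculus

variable {X Y : Type*} [NormedAddCommGroup X] [NormedSpace ℝ X] [NormedAddCommGroup Y] [NormedSpace ℝ Y]

/-- **Equivariance of the renormalisation map.**  If `Φ ∘ T = S ∘ Φ` and `Q (T x) (T y) = S (Q x y)` then
`Φ⁻¹ (Q (T v) (T v)) = T (Φ⁻¹ (Q v v))`. [folklore] -/
theorem renorm_equivariant (Q : X →L[ℝ] X →L[ℝ] Y) (Φ : X ≃L[ℝ] Y) (T : X →L[ℝ] X) (S : Y →L[ℝ] Y)
    (hΦT : ∀ x : X, Φ (T x) = S (Φ x)) (hQT : ∀ x y : X, Q (T x) (T y) = S (Q x y)) (v : X) :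
    Φ.symm (Q (T v) (T v)) = T (Φ.symm (Q v v)) := by
  apply Φ.injective
  rw [ContinuousLinearEquiv.apply_symm_apply, hQT, hΦT, ContinuousLinearEquiv.apply_symm_apply]

/-- **Zeros come in symmetry orbits.**  If `Φ ∘ T = S ∘ Φ` (with `Φ` realising `A`) and `Q (T x) (T y) = S (Q x y)`, then
`A x + Q x x = 0` implies `A (T x) + Q (T x) (T x) = 0`. [folklore] -/
theorem quadratic_zero_map_of_equivariant (A : X →L[ℝ] Y) (Q : X →L[ℝ] X →L[ℝ] Y) (Φ : X ≃L[ℝ] Y)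
    (hΦ : (Φ : X →L[ℝ] Y) = A) (T : X →L[ℝ] X) (S : Y →L[ℝ] Y)
    (hΦT : ∀ x : X, Φ (T x) = S (Φ x)) (hQT : ∀ x y : X, Q (T x) (T y) = S (Q x y)) {x : X}
    (hx : A x + Q x x = 0) : A (T x) + Q (T x) (T x) = 0 := by
  have hA : ∀ w : X, A w = Φ w := by
    intro w
    have h2 : (Φ : X →L[ℝ] Y) w = A w := by rw [hΦ]
    rw [ContinuousLinearEquiv.coe_coe] at h2
    exact h2.symm
  rw [hA, hΦT, hQT, ← map_add, ← hA, hx, map_zero]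

/-- **A relative eigen-direction off its own line carries no zero.**  If `Φ⁻¹ (Q v v) = μ • w` with `μ ≠ 0` and `w ∉ ℝ v`
(typically `w = T v` for a symmetry `T` that moves the direction `v`), then no nonzero rescaling of `v` is a zero:
`A (c • v) + Q (c • v) (c • v) ≠ 0` for every `c ≠ 0`.  (By `quadratic_zero_smul_iff_renorm_eq_smul` a zero on `ℝ v` forces
`Φ⁻¹ (Q v v) ∈ ℝ v`.) [folklore] -/
theorem not_quadratic_zero_smul_of_renorm_eq_smul_of_notMem_span (A : X →L[ℝ] Y) (Q : X →L[ℝ] X →L[ℝ] Y)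
    (Φ : X ≃L[ℝ] Y) (hΦ : (Φ : X →L[ℝ] Y) = A) {μ : ℝ} (hμ : μ ≠ 0) {v w : X}
    (hvw : Φ.symm (Q v v) = μ • w) (hw : w ∉ Submodule.span ℝ ({v} : Set X)) {c : ℝ} (hc : c ≠ 0) :
    A (c • v) + Q (c • v) (c • v) ≠ 0 := by
  intro h
  have h1 := (quadratic_zero_smul_iff_renorm_eq_smul A Q Φ hΦ hc v).mp h
  rw [hvw] at h1
  -- μ • w = (-c⁻¹) • v  ⇒  w = μ⁻¹ • ((-c⁻¹) • v) ∈ span {v}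
  have h2 : w = μ⁻¹ • ((-c⁻¹) • v) := by
    rw [← h1, smul_smul, inv_mul_cancel₀ hμ, one_smul]
  apply hw
  rw [h2, smul_smul]
  exact Submodule.smul_mem _ _ (Submodule.mem_span_singleton_self v)

/-- **Relative eigen-directions propagate along the symmetry with the same multiplier**: if `N` is `T`-equivariant
(hypotheses of `renorm_equivariant`) and `Φ⁻¹ (Q v v) = μ • T v`, then `Φ⁻¹ (Q (T v) (T v)) = μ • T (T v)` — the whole
`T`-orbit of `v` consists of relative eigen-directions with the same `(μ, T)`. [folklore] -/
theorem renorm_eq_smul_map_of_equivariant (Q : X →L[ℝ] X →L[ℝ] Y) (Φ : X ≃L[ℝ] Y) (T : X →L[ℝ] X) (S : Y →L[ℝ] Y)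
    (hΦT : ∀ x : X, Φ (T x) = S (Φ x)) (hQT : ∀ x y : X, Q (T x) (T y) = S (Q x y)) {μ : ℝ} {v : X}
    (hv : Φ.symm (Q v v) = μ • T v) : Φ.symm (Q (T v) (T v)) = μ • T (T v) := by
  rw [renorm_equivariant Q Φ T S hΦT hQT v, hv, map_smul]

/-- **If the aligning symmetry fixes the direction, a relative eigen-direction is a genuine one**: `Φ⁻¹ (Q v v) = μ • T v` and
`T v = v` give `Φ⁻¹ (Q v v) = μ • v`. [folklore] -/
theorem renorm_eq_smul_of_relative_of_map_eq (Q : X →L[ℝ] X →L[ℝ] Y) (Φ : X ≃L[ℝ] Y) (T : X →L[ℝ] X) {μ : ℝ} {v : X}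
    (hv : Φ.symm (Q v v) = μ • T v) (hTv : T v = v) : Φ.symm (Q v v) = μ • v := by
  rw [hv, hTv]

/-- … and then it carries the zero `x = (-μ⁻¹) • v` (`μ ≠ 0`; `quadratic_zero_of_renorm_eigen`). [folklore] -/
theorem quadratic_zero_of_relative_of_map_eq (A : X →L[ℝ] Y) (Q : X →L[ℝ] X →L[ℝ] Y) (Φ : X ≃L[ℝ] Y)
    (hΦ : (Φ : X →L[ℝ] Y) = A) (T : X →L[ℝ] X) {μ : ℝ} (hμ : μ ≠ 0) {v : X}
    (hv : Φ.symm (Q v v) = μ • T v) (hTv : T v = v) :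
    A ((-μ⁻¹) • v) + Q ((-μ⁻¹) • v) ((-μ⁻¹) • v) = 0 :=
  quadratic_zero_of_renorm_eigen A Q Φ hΦ hμ (renorm_eq_smul_of_relative_of_map_eq Q Φ T hv hTv)

/-! ### The linearisation at a zero: Euler identity (radial eigenvalue `−1`) and symmetry generators in the kernel -/

/-- **Derivative of a quadratic map.**  `x ↦ A x + Q x x` has Fréchet derivative `A + Q x + Q.flip x` at `x`
(`h ↦ A h + Q x h + Q h x`). [folklore] -/
theorem hasFDerivAt_quadratic (A : X →L[ℝ] Y) (Q : X →L[ℝ] X →L[ℝ] Y) (x : X) :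
    HasFDerivAt (fun z => A z + Q z z) (A + (Q x + Q.flip x)) x := by
  have hQ : HasFDerivAt (fun z : X => Q z z)
      (Q.precompR X x (ContinuousLinearMap.id ℝ X) + Q.precompL X (ContinuousLinearMap.id ℝ X) x) x :=
    Q.hasFDerivAt_of_bilinear (hasFDerivAt_id x) (hasFDerivAt_id x)
  have hQ' : HasFDerivAt (fun z : X => Q z z) (Q x + Q.flip x) x := by
    convert hQ using 1
    ext h
    simp [ContinuousLinearMap.precompR_apply, ContinuousLinearMap.precompL_apply, ContinuousLinearMap.flip_apply]
  exact A.hasFDerivAt.add hQ'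

/-- **Euler identity at a zero.**  If `A x + Q x x = 0` then the linearisation `DG(x) = A + Q x + Q.flip x` satisfies
`DG(x) x = −A x` (degree-two homogeneity of the quadratic part: `Q x x + Q x x = 2 Q x x = −2 A x`). [folklore] -/
theorem linearisation_apply_self_of_quadratic_zero (A : X →L[ℝ] Y) (Q : X →L[ℝ] X →L[ℝ] Y) {x : X}
    (hx : A x + Q x x = 0) : (A + (Q x + Q.flip x)) x = -(A x) := by
  simp only [FunLike.coe_add, Pi.add_apply, ContinuousLinearMap.flip_apply]
  have : Q x x = -(A x) := eq_neg_of_add_eq_zero_right hx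
  rw [this]; abel

/-- The same identity stated for `fderiv`. [folklore] -/
theorem fderiv_quadratic_apply_self_of_zero (A : X →L[ℝ] Y) (Q : X →L[ℝ] X →L[ℝ] Y) {x : X}
    (hx : A x + Q x x = 0) : fderiv ℝ (fun z => A z + Q z z) x x = -(A x) := by
  rw [(hasFDerivAt_quadratic A Q x).fderiv]
  exact linearisation_apply_self_of_quadratic_zero A Q hx

/-- **Radial eigenvalue `−1` of the preconditioned Jacobian at every zero.**  With `Φ : X ≃L Y` realising `A`, a zero `x` of
`A x + Q x x` satisfies `Φ⁻¹ (DG(x) x) = −x`: the `A`-preconditioned linearisation has the eigenvalue `−1` on the line `ℝ x` (for `x ≠ 0`).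
This is the radial instability factored out by the normalisation of Petviashvili-type («shape-sphere») iterations, and a parameter-free
identity any numerically converged nonzero zero must satisfy to rounding. [folklore] -/
theorem precond_linearisation_apply_self_of_quadratic_zero (A : X →L[ℝ] Y) (Q : X →L[ℝ] X →L[ℝ] Y)
    (Φ : X ≃L[ℝ] Y) (hΦ : (Φ : X →L[ℝ] Y) = A) {x : X} (hx : A x + Q x x = 0) :
    Φ.symm ((A + (Q x + Q.flip x)) x) = -x := by
  rw [linearisation_apply_self_of_quadratic_zero A Q hx, map_neg]
  congr 1
  have : A x = Φ x := by
    have h2 : (Φ : X →L[ℝ] Y) x = A x := by rw [hΦ]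
    rw [ContinuousLinearEquiv.coe_coe] at h2
    exact h2.symm
  rw [this, ContinuousLinearEquiv.symm_apply_apply]

/-- **Symmetry generators under the linearisation.**  Let `t ↦ T t` and `t ↦ S t` be families of bounded linear maps on `X` and `Y`,
differentiable at `t = 0` with `T 0 = id`, `S 0 = id` and derivatives `T′`, `S′`, such that the quadratic map is equivariant:
`A (T t x) + Q (T t x) (T t x) = S t (A x + Q x x)` for all `t, x`.  Then `DG(x) (T′ x) = S′ (A x + Q x x)` (differentiate the
equivariance identity at `t = 0`). [folklore] -/
theorem linearisation_apply_generator_of_equivariant (A : X →L[ℝ] Y) (Q : X →L[ℝ] X →L[ℝ] Y)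
    (T : ℝ → X →L[ℝ] X) (S : ℝ → Y →L[ℝ] Y) (T' : X →L[ℝ] X) (S' : Y →L[ℝ] Y)
    (hT : HasDerivAt (fun t => T t) T' 0) (hS : HasDerivAt (fun t => S t) S' 0) (hT0 : T 0 = ContinuousLinearMap.id ℝ X)
    (hS0 : S 0 = ContinuousLinearMap.id ℝ Y)
    (hequiv : ∀ t x, A (T t x) + Q (T t x) (T t x) = S t (A x + Q x x)) (x : X) :
    (A + (Q x + Q.flip x)) (T' x) = S' (A x + Q x x) := by
  -- differentiate t ↦ G(T t x) = S t (G x) at t = 0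
  have hT0x : T 0 x = x := by rw [hT0]; rfl
  have h1 : HasDerivAt (fun t => T t x) (T' x) 0 := by
    have := hT.clm_apply (hasDerivAt_const (0:ℝ) x)
    simpa [hT0] using this
  have hG : HasFDerivAt (fun z => A z + Q z z) (A + (Q x + Q.flip x)) x := hasFDerivAt_quadratic A Q x
  have h2 : HasDerivAt ((fun z => A z + Q z z) ∘ (fun t => T t x)) ((A + (Q x + Q.flip x)) (T' x)) 0 :=
    hG.comp_hasDerivAt_of_eq 0 h1 hT0x.symm
  have h3 : HasDerivAt (fun t => S t (A x + Q x x)) (S' (A x + Q x x)) 0 := by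
    have := hS.clm_apply (hasDerivAt_const (0:ℝ) (A x + Q x x))
    simpa [hS0] using this
  have heq : ((fun z => A z + Q z z) ∘ (fun t => T t x)) = fun t => S t (A x + Q x x) := by
    funext t; exact hequiv t x
  rw [heq] at h2
  exact h2.unique h3

/-- **At a zero, symmetry generators lie in the kernel of the linearisation** (`DG(x) (T′ x) = 0`): the neutral directions
(eigenvalue `1` of the shape-map tangent, eigenvalue `0` of `Φ⁻¹ DG(x)`) that a gauge fixing / phase alignment removes. [folklore] -/
theorem linearisation_apply_generator_eq_zero_of_quadratic_zero (A : X →L[ℝ] Y) (Q : X →L[ℝ] X →L[ℝ] Y)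
    (T : ℝ → X →L[ℝ] X) (S : ℝ → Y →L[ℝ] Y) (T' : X →L[ℝ] X) (S' : Y →L[ℝ] Y)
    (hT : HasDerivAt (fun t => T t) T' 0) (hS : HasDerivAt (fun t => S t) S' 0) (hT0 : T 0 = ContinuousLinearMap.id ℝ X)
    (hS0 : S 0 = ContinuousLinearMap.id ℝ Y)
    (hequiv : ∀ t x, A (T t x) + Q (T t x) (T t x) = S t (A x + Q x x)) {x : X} (hx : A x + Q x x = 0) :
    (A + (Q x + Q.flip x)) (T' x) = 0 := by
  rw [linearisation_apply_generator_of_equivariant A Q T S T' S' hT hS hT0 hS0 hequiv x, hx, map_zero]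

/-! ### The residual of the «would-be zero» is the shape-map defect seen through `Φ` -/

/-- **Residual of the would-be zero.**  For any `μ ≠ 0` (typically `μ = ±‖Φ⁻¹ (Q v v)‖`, so that `μ⁻¹ • Φ⁻¹ (Q v v)` is the signed
shape-map image `Φ_s(v)` of a unit direction `v`), the candidate zero `V = (−μ⁻¹) • v` has residual
`A V + Q V V = μ⁻¹ • Φ (μ⁻¹ • Φ⁻¹ (Q v v) − v)`: the residual of the would-be zero IS the (un-aligned) shape-map defect transported by
`Φ` and scaled by the amplitude — they vanish together (the identity behind the `res_of_would_be_zero` print of the Z7 device (g)).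
(Also true for `μ = 0` with Lean's `0⁻¹ = 0`.) [folklore] -/
theorem quadratic_apply_wouldBeZero (A : X →L[ℝ] Y) (Q : X →L[ℝ] X →L[ℝ] Y) (Φ : X ≃L[ℝ] Y)
    (hΦ : (Φ : X →L[ℝ] Y) = A) (μ : ℝ) (v : X) :
    A ((-μ⁻¹) • v) + Q ((-μ⁻¹) • v) ((-μ⁻¹) • v) = μ⁻¹ • Φ (μ⁻¹ • Φ.symm (Q v v) - v) := by
  rw [quadratic_apply_smul_eq A Q Φ hΦ (-μ⁻¹) v,
    show μ⁻¹ • Φ (μ⁻¹ • Φ.symm (Q v v) - v) = Φ (μ⁻¹ • (μ⁻¹ • Φ.symm (Q v v) - v)) from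
      (Φ.map_smul _ _).symm]
  congr 1
  rw [smul_sub, smul_smul, neg_mul_neg, neg_smul, sub_eq_add_neg, add_comm]

/-- **Norm form**: `‖A V + Q V V‖ = |μ|⁻¹ · ‖Φ (μ⁻¹ • Φ⁻¹ (Q v v) − v)‖` for `V = (−μ⁻¹) • v` — the scale-free reading «residual of the
would-be zero = `Φ`-weighted shape defect / amplitude». [folklore] -/
theorem norm_quadratic_apply_wouldBeZero (A : X →L[ℝ] Y) (Q : X →L[ℝ] X →L[ℝ] Y) (Φ : X ≃L[ℝ] Y)
    (hΦ : (Φ : X →L[ℝ] Y) = A) (μ : ℝ) (v : X) :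
    ‖A ((-μ⁻¹) • v) + Q ((-μ⁻¹) • v) ((-μ⁻¹) • v)‖ = |μ|⁻¹ * ‖Φ (μ⁻¹ • Φ.symm (Q v v) - v)‖ := by
  rw [quadratic_apply_wouldBeZero A Q Φ hΦ μ v, norm_smul, norm_inv, Real.norm_eq_abs]

end Summit.NavierStokesRegularity.NavierStokesRegularity.Theorems.QuadraticRenormSymmetry

end
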